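import Literature.NumberTheory.Automorphic.JacquetLemmaCounterexample
import HarnessLib

/-!
# The named fact `Representation.jacquet_exact` is false as stated

The fact `Representation.jacquet_exact` (file `Literature.NumberTheory.Automorphic.JacquetModule`;
Bernstein–Zelevinsky 1976, Prop. 2.35: exactness of the Jacquet functor on smooth
representations) sits in the same `section CharZero` as `Representation.isAdmissible_jacquetModule`
and suffers the same defect: its body mentions neither `[CharZero k]` nor `[IsTopologicalGroup G]`,
so Lean dropped both section instances and the registered constant is
`Representation.jacquet_exact.{u₁,…,u₅} : ∀ {k G} [Field k] [Group G] [TopologicalSpace G], Prop`,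
quantifying over fields of *every* characteristic — although its own docstring records that
"over `k = 𝔽_p` exactness already fails". This file proves the registered statement **false**
(`Representation.not_jacquet_exact`), reusing the counterexample of
`Literature.NumberTheory.Automorphic.JacquetLemmaCounterexample`:

* `G = ∏_ℕ ℤ/2ℤ` (`Grp`), `k = 𝔽₂`, the triple `t = (G, 1, G)` (`triple`), for which `N = G` is
  compact, hence trivially a limit of compact open subgroups (`isLimitOfCompactOpen_triple_N`);
* the short exact sequence of smooth representations
  `0 → 𝔽₂ —inlHom→ V = 𝔽₂ ⊕ 𝔽₂^{(ℕ)} —sndHom→ 𝔽₂^{(ℕ)} → 0` (trivial, `unipRep` with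
  `g · (a, b) = (a - ∑ⱼ bⱼ gⱼ, b)`, trivial);
* on Jacquet modules (`G`-coinvariants) the first map is `𝔽₂ = (𝔽₂)_G → V_G`, `1 ↦ [(1, 0)]`, and
  `[(1, 0)] = 0` in `V_G` because `(1, 0) = -(ρ(δ₀)(0, e₀) - (0, e₀))` (`mk_one_zero_eq_zero`),
  while `[1] ≠ [0]` in `(𝔽₂)_G = 𝔽₂` (`mk_trivial_injective`); so `jacquetMap t inlHom` is not
  injective (`not_jacquet_exact_instance`).

Consequently the theorem `Representation.jacquet_exact_holds` of `JacquetModuleExactProofs`,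
whose mathematics is correct, carries the two *extra* instance binders
`[CharZero k] [IsTopologicalGroup G]` relative to the constant `jacquet_exact`: it is the intended
theorem (a conditional form of the registered fact), not a discharge of it, and it does not
contradict `not_jacquet_exact`. The corrected statement, fully closed, is vendored and discharged
in the sibling file `Literature.NumberTheory.Automorphic.JacquetModuleExactCorrected`
(`Representation.jacquet_exact_of_charZero`, `…_holds`).

## References

* I. N. Bernstein, A. V. Zelevinsky, *Representations of the group `GL(n, F)` where `F` is a
  non-archimedean local field*, Russian Math. Surveys 31 (1976), Prop. 2.35 (the correct
  statement, over `ℂ`; not held, cited after `JacquetModule`).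
* W. Casselman, *Introduction to the theory of admissible representations of `p`-adic reductive
  groups*, draft 1 May 1995, Prop. 3.2.3 (exactness of `V ↦ V_N` for smooth `N`-spaces over `ℂ`).
-/
namespace Literature.NumberTheory.Automorphic.JacquetLemma.Counterexample

open _root_.Representation

/-- The inclusion `𝔽₂ → V`, `a ↦ (a, 0)`, an injective intertwining map from the trivial
representation into `unipRep` (its image `𝔽₂ (1, 0)` is the line fixed by `G`). [folklore] -/
noncomputable def inlHom :
    (Representation.trivial (ZMod 2) Grp (ZMod 2)).IntertwiningMap unipRep where
  toLinearMap := LinearMap.inl (ZMod 2) (ZMod 2) (ℕ →₀ ZMod 2)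
  isIntertwining' g := LinearMap.ext fun a => Prod.ext (by simp) rfl

/-- `inlHom a = (a, 0)`. [folklore] -/
@[simp] lemma inlHom_apply (a : ZMod 2) : inlHom a = (a, 0) := rfl

/-- `inlHom` is injective. [folklore] -/
lemma inlHom_injective : Function.Injective inlHom := fun _ _ h => congrArg Prod.fst h

/-- The projection `V → 𝔽₂^{(ℕ)}`, `(a, b) ↦ b`, a surjective intertwining map from `unipRep`
onto the trivial representation on `𝔽₂^{(ℕ)}`. [folklore] -/
noncomputable def sndHom :
    unipRep.IntertwiningMap (Representation.trivial (ZMod 2) Grp (ℕ →₀ ZMod 2)) where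
  toLinearMap := LinearMap.snd (ZMod 2) (ZMod 2) (ℕ →₀ ZMod 2)
  isIntertwining' _ := LinearMap.ext fun _ => rfl

/-- `sndHom (a, b) = b`. [folklore] -/
@[simp] lemma sndHom_apply (v : Vec) : sndHom v = v.2 := rfl

/-- `sndHom` is surjective. [folklore] -/
lemma sndHom_surjective : Function.Surjective sndHom := fun b => ⟨((0 : ZMod 2), b), rfl⟩

/-- `0 → 𝔽₂ → V → 𝔽₂^{(ℕ)} → 0` is exact in the middle. [folklore] -/
lemma exact_inlHom_sndHom : Function.Exact inlHom sndHom := Function.Exact.inl_snd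

/-- A trivial representation is smooth (every stabiliser is the whole group). [folklore] -/
lemma isSmooth_trivial (W : Type) [AddCommGroup W] [Module (ZMod 2) W] :
    (Representation.trivial (ZMod 2) Grp W).IsSmooth := fun v =>
  (Representation.trivial (ZMod 2) Grp W).isSmoothVector_of_le (K := ⊤)
    (by rw [Subgroup.coe_top]; exact isOpen_univ) fun g _ => by simp

/-- `N = G` is (trivially) a limit of compact open subgroups: `G` itself is compact. [folklore] -/
lemma isLimitOfCompactOpen_triple_N : IsLimitOfCompactOpen triple.N := by
  intro C _
  have hcs : CompactSpace triple.N := by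
    change CompactSpace ((⊤ : Subgroup Grp) : Set Grp)
    exact isCompact_iff_compactSpace.1 (by rw [Subgroup.coe_top]; exact isCompact_univ)
  refine ⟨⊤, ?_, ?_, fun x _ => Subgroup.mem_top x⟩
  · rw [Subgroup.coe_top]; exact isOpen_univ
  · rw [Subgroup.coe_top]; exact isCompact_univ

/-- In `V_G` the class of `(1, 0)` vanishes: `(1, 0) = -(ρ(δ₀) v - v)` for `v = (0, e₀)`.
[folklore] -/
lemma mk_one_zero_eq_zero :
    Coinvariants.mk (triple.restrict unipRep) ((1 : ZMod 2), (0 : ℕ →₀ ZMod 2)) = 0 := by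
  have h := Coinvariants.mk_self_apply (triple.restrict unipRep)
    ⟨⟨Pi.mulSingle 0 (Multiplicative.ofAdd 1), Subgroup.mem_top _⟩,
      Subgroup.mem_subgroupOf.2 (Subgroup.mem_top _)⟩ ((0 : ZMod 2), Finsupp.single 0 (1 : ZMod 2))
  -- `ρ(δ₀)(0, e₀) = (-1, e₀)`, so `[(-1, e₀)] = [(0, e₀)]` and
  -- `[(1, 0)] = -([(-1, e₀)] - [(0, e₀)]) = 0`
  have hval : (triple.restrict unipRep)
      ⟨⟨Pi.mulSingle 0 (Multiplicative.ofAdd 1), Subgroup.mem_top _⟩,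
        Subgroup.mem_subgroupOf.2 (Subgroup.mem_top _)⟩
        ((0 : ZMod 2), Finsupp.single 0 (1 : ZMod 2)) =
      ((-1 : ZMod 2), Finsupp.single 0 (1 : ZMod 2)) := by
    refine Prod.ext ?_ rfl
    show (0 : ZMod 2) - lc (Pi.mulSingle 0 (Multiplicative.ofAdd 1)) (Finsupp.single 0 1) = -1
    rw [lc_mulSingle, Finsupp.single_eq_same, zero_sub]
  rw [hval] at h
  have h2 : ((1 : ZMod 2), (0 : ℕ →₀ ZMod 2)) =
      -((((-1 : ZMod 2), Finsupp.single 0 (1 : ZMod 2)) : Vec) -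
        ((0 : ZMod 2), Finsupp.single 0 1)) := by
    refine Prod.ext ?_ ?_ <;> simp
  rw [h2, map_neg, map_sub, h, sub_self, neg_zero]

/-- The coinvariants of a trivial representation see every vector: `[x] = [y] → x = y`.
[folklore] -/
lemma mk_trivial_injective (W : Type) [AddCommGroup W] [Module (ZMod 2) W] :
    Function.Injective
      (Coinvariants.mk (triple.restrict (Representation.trivial (ZMod 2) Grp W))) := by
  intro x y hxy
  have hker : Coinvariants.ker (triple.restrict (Representation.trivial (ZMod 2) Grp W)) ≤ ⊥ := by
    refine Submodule.span_le.2 ?_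
    rintro _ ⟨⟨g, v⟩, rfl⟩
    simp
  have h := hker ((Coinvariants.mk_eq_iff _).1 hxy)
  rwa [Submodule.mem_bot, sub_eq_zero] at h

/-- **Exactness fails**: for the short exact sequence `0 → 𝔽₂ → V → 𝔽₂^{(ℕ)} → 0` of smooth
representations of `G = ∏_ℕ ℤ/2ℤ` (trivial, `unipRep`, trivial) and the triple `(G, 1, G)`, the
map of Jacquet modules `𝔽₂ = (𝔽₂)_G → V_G` kills `1 ↦ [(1, 0)] = 0`, so it is not injective,
although `N = G` is a limit of compact open subgroups. Hence the registered (characteristic-free)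
constant `Representation.jacquet_exact` fails at `(k, G) = (𝔽₂, ∏_ℕ ℤ/2ℤ)`. [folklore] -/
theorem not_jacquet_exact_instance :
    ¬ Representation.jacquet_exact.{0, 0, 0, 0, 0} (k := ZMod 2) (G := Grp) := by
  intro h
  have hinj := (h triple isLimitOfCompactOpen_triple_N (isSmooth_trivial (ZMod 2)) isSmooth_unipRep
    (isSmooth_trivial (ℕ →₀ ZMod 2)) inlHom sndHom inlHom_injective exact_inlHom_sndHom
    sndHom_surjective).1
  have h1 : jacquetMap triple inlHom
      (Coinvariants.mk (triple.restrict (Representation.trivial (ZMod 2) Grp (ZMod 2))) 1) =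
      jacquetMap triple inlHom
        (Coinvariants.mk (triple.restrict (Representation.trivial (ZMod 2) Grp (ZMod 2))) 0) := by
    rw [jacquetMap_mk, jacquetMap_mk, map_zero, map_zero]
    exact mk_one_zero_eq_zero
  exact one_ne_zero (mk_trivial_injective (ZMod 2) (hinj h1))

end Literature.NumberTheory.Automorphic.JacquetLemma.Counterexample

namespace Representation

open Literature.NumberTheory.Automorphic

/-- **The mis-stated fact `Representation.jacquet_exact` is false.** Like
`Representation.isAdmissible_jacquetModule`, the `def Representation.jacquet_exact` (file
`JacquetModule`; Bernstein–Zelevinsky 1976, Prop. 2.35) lost the section instances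
`[CharZero k] [IsTopologicalGroup G]` its docstring relies on ("for `k` a field of characteristic
`0`"; the docstring itself observes that exactness fails over `𝔽_p`), so the registered constant
quantifies over all fields; its universal closure fails at `(𝔽₂, ∏_ℕ ℤ/2ℤ)`
(`JacquetLemma.Counterexample.not_jacquet_exact_instance`: `0 → 𝔽₂ → 𝔽₂ ⊕ 𝔽₂^{(ℕ)} → 𝔽₂^{(ℕ)} → 0`
with `g · (a, b) = (a - ∑ⱼ bⱼ gⱼ, b)` and the triple `(G, 1, G)`; `(𝔽₂)_G → V_G` is zero).
[folklore] -/
theorem not_jacquet_exact :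
    ¬ ∀ {k G : Type} [Field k] [Group G] [TopologicalSpace G],
      jacquet_exact.{0, 0, 0, 0, 0} (k := k) (G := G) :=
  fun h => JacquetLemma.Counterexample.not_jacquet_exact_instance h

end Representation
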